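import Summits.HubbardSuperconductivity.HubbardSuperconductivity.Theorems.LogColdTorusAverageToEveryOfBir
import Summits.HubbardSuperconductivity.HubbardSuperconductivity.Theorems.BirGroundStateAverageLRO.Negative.RegimeMap
import HarnessLib

/-!
# Route `LogColdTorus`, crux `AverageToEvery` (item `stmt-HubbardSuperconductivity-10519`, shared with route
`AbelianDuality`): the REGIME MAP of the crux's own window hypothesis, and the crux's live region

Helpers (`--supports`) for the crux
`Summit.HubbardSuperconductivity.HubbardSuperconductivity.Theses.LogColdTorus.AverageToEvery` (lead c20).

The crux quantifies over ALL data `(δ, U₁, U₂, c, L₀)` (`δ ∈ ℝ`, `0 < U₁ < U₂`, `0 < c`); its hypothesis is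
the BLOCK-format window bound "for every `U ∈ (U₁, U₂)` and every even `L ≥ L₀` the tracial sector
ground-state average of `Δ_d† Δ_d` (compression of `hubbardTorus 2 L 1 U` to the occupation block
`#s = N_L ∧ 2·#{↑ ∈ s} = N_L`, `N_L = 2⌊(1-δ)L²/2⌋`) is `≥ c L⁴`", with ONE threshold `L₀` for the whole
window. The sibling target `BalabanIR.BirGroundStateAverageLRO` (stmt-2079) states the same bound in
PROJECTOR format (`c L⁴ · re tr P ≤ re tr (P Δ_d† Δ_d)`, `P` the sector ground projector) with a threshold
per coupling, and its standing a-priori side (`Theorems/BirGroundStateAverageLRO/Negative/*`) confines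
its witnesses to a regime map. This file transports that map to the crux's own hypothesis over the
crux's full filling range, and reads off where the crux is settled by vacuity:

* `projBound_of_blockBound`, `projWindow_of_blockWindow` — the block bound at `(U, L)` IS the projector
  bound at `(U, L)` (`δ ≥ -1`, `c > 0`; dictionary `hubbardTorus_blockGroundStateFunctional_eq_traceAverage`,
  `tr P = dim E₀ ≥ 1`), so the crux's window hypothesis implies the sibling's, with the same threshold;
* `blockWindow_const_le_yang` — Yang's kinematic ceiling `c ≤ 2(1-δ)(1+δ)` for `0 ≤ δ ≤ 1`
  (the sibling's `avgBound_const_le_yang`, window form re-derived on `[0, 1]` instead of `(0, 1/2)`);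
* `blockWindow_const_le_carrier` — the carrier ceiling `c ≤ 80δ + 640/U₂` for `0 ≤ δ ≤ 1`, `0 < U₁`
  (`avgBound_const_le_carrier`, couplings `U ↑ U₂`);
* `blockWindow_floor`, `blockWindow_const_le_weakCeiling` — the pairing-cost floor
  `c/(10⁵ log²(4+32/√c)) ≤ U₁` (`δ ≥ -1`, `0 ≤ U₁`) and its closed-form inversion
  `c ≤ 10⁵ U₁ log²(4+32/√U₁)` (`0 < U₁`);
* `blockWindow_regimeMap` — the conjunction, for every block witness with `-1 ≤ δ ≤ 1`.

The sequel `LogColdTorusAverageToEveryLiveRegion.lean` reads this map on the crux: off the map its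
instances hold vacuously, and the crux is equivalent to its restriction to the live region (doped
fillings, constants below Yang's and the carrier ceiling, windows above the pairing-cost floor).

Sources: C. N. Yang, Rev. Mod. Phys. 34 (1962) 694, §3; F. C. Zhang, C. Gross, T. M. Rice, H. Shiba,
Supercond. Sci. Technol. 1 (1988) 36, §2; J. Bardeen, L. N. Cooper, J. R. Schrieffer, Phys. Rev. 108
(1957) 1175, §II; H. Tasaki (2020) §2.1–2.2. Folklore finite-dimensional bookkeeping over landed
theorems; no definition and no named fact is introduced; nothing asserts a Theses decl.
-/

noncomputable section

-- `dupNamespace`: the summit and the problem are both named `HubbardSuperconductivity` (layout D-0022)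
set_option linter.dupNamespace false

namespace Summit.HubbardSuperconductivity.HubbardSuperconductivity.Theorems

open Matrix Finset Filter
open Literature.Probability.LatticeModels Literature.MathematicalPhysics.QuantumLattice
open Summit.HubbardSuperconductivity.HubbardSuperconductivity.Theorems.BirGroundStateAverageLRO.Negative
  (avgBound_const_le_yang avgBound_const_le_carrier birGroundStateAverageLRO_window_floor_uniform)
open scoped ComplexOrder Matrix Classical

/-! ## §1 The block bound is the projector bound -/

/-- **Block bound ⇒ projector bound, at one `(U, L)`.** For `δ ≥ -1` and `c > 0`: if the tracial
ground-state functional of the compression of `hubbardTorus 2 L 1 U` to the `(N_L, S^z = 0)` occupation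
block gives the compressed `Δ_d† Δ_d` a real part `≥ c L⁴`, then `c L⁴ · re tr P ≤ re tr (P Δ_d† Δ_d)`
for the projection `P` onto the sector ground eigenspace `E₀ = szSector N_L 0 ⊓ ker (H - e₀)`. (The block
average is `(tr P)⁻¹ tr (P Δ_d† Δ_d)` by `hubbardTorus_blockGroundStateFunctional_eq_traceAverage`
— `⌊(1-δ)L²/2⌋ ≤ L²` for `δ ≥ -1` — and `tr P = dim E₀ ∈ ℕ`; `dim E₀ = 0` would make the average
`0 < c L⁴`.) Tasaki (2020) §2.1. [folklore] -/
theorem projBound_of_blockBound (L : ℕ) [NeZero L] {δ U c : ℝ} (hδ : -1 ≤ δ) (hc : 0 < c)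
    (h : let p : Finset (Orb (FermionTorus 2 L)) → Prop := fun s =>
          s.card = 2 * ⌊(1 - δ) * (L : ℝ) ^ 2 / 2⌋₊ ∧
            2 * (s.filter fun i => (ofLex i).2 = 0).card = 2 * ⌊(1 - δ) * (L : ℝ) ^ 2 / 2⌋₊
        c * (L : ℝ) ^ 4 ≤ (((hubbardTorus 2 L 1 U).toBlock p p).groundStateFunctional
          (((pairField dWaveFormFactor L)ᴴ * pairField dWaveFormFactor L).toBlock p p)).re) :
    let N : ℕ := 2 * ⌊(1 - δ) * (L : ℝ) ^ 2 / 2⌋₊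
    let H := hubbardTorus 2 L 1 U
    let S := szSector (Λ := FermionTorus 2 L) N 0
    let E₀ := S ⊓ Module.End.eigenspace (Matrix.toLin' H) ((H.minEnergyOn S : ℝ) : ℂ)
    let P := projMatrix (E₀.map (Fock.toEuclidean (ι := Orb (FermionTorus 2 L)) :
      Fock (Orb (FermionTorus 2 L)) →ₗ[ℂ] EuclideanSpace ℂ (Finset (Orb (FermionTorus 2 L)))))
    c * (L : ℝ) ^ 4 * P.trace.re ≤
      (P * ((pairField dWaveFormFactor L)ᴴ * pairField dWaveFormFactor L)).trace.re := by
  dsimp only at h ⊢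
  -- abbreviations for the objects of side `L` at the coupling `U`
  set Y : Matrix (Finset (Orb (FermionTorus 2 L))) (Finset (Orb (FermionTorus 2 L))) ℂ :=
    (pairField dWaveFormFactor L)ᴴ * pairField dWaveFormFactor L with hY
  set E₀ : Submodule ℂ (Fock (Orb (FermionTorus 2 L))) :=
    szSector (Λ := FermionTorus 2 L) (2 * ⌊(1 - δ) * (L : ℝ) ^ 2 / 2⌋₊) 0 ⊓
      Module.End.eigenspace (Matrix.toLin' (hubbardTorus 2 L 1 U))
        ((((hubbardTorus 2 L 1 U).minEnergyOn
          (szSector (Λ := FermionTorus 2 L) (2 * ⌊(1 - δ) * (L : ℝ) ^ 2 / 2⌋₊) 0)) : ℝ) : ℂ)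
    with hE₀
  set P : Matrix (Finset (Orb (FermionTorus 2 L))) (Finset (Orb (FermionTorus 2 L))) ℂ :=
    projMatrix (E₀.map (Fock.toEuclidean (ι := Orb (FermionTorus 2 L)) :
      Fock (Orb (FermionTorus 2 L)) →ₗ[ℂ] EuclideanSpace ℂ (Finset (Orb (FermionTorus 2 L)))))
    with hP
  -- the block hypothesis in projector form
  have hn : ⌊(1 - δ) * (L : ℝ) ^ 2 / 2⌋₊ ≤ L ^ 2 := NoGo.floor_pairNumber_le δ hδ L
  rw [hubbardTorus_blockGroundStateFunctional_eq_traceAverage L 1 U _ hn] at h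
  change c * (L : ℝ) ^ 4 ≤ ((P.trace)⁻¹ * (P * Y).trace).re at h
  change c * (L : ℝ) ^ 4 * P.trace.re ≤ (P * Y).trace.re
  -- `tr P = dim E₀`
  have htr : P.trace = (Module.finrank ℂ E₀ : ℂ) := by
    rw [hP, map_toEuclidean_eq]
    exact trace_projMatrix_map_eq_finrank E₀
  set d : ℕ := Module.finrank ℂ E₀ with hd
  rw [htr, ← Complex.ofReal_natCast, ← Complex.ofReal_inv, Complex.re_ofReal_mul] at h
  rw [htr, Complex.natCast_re]
  -- `d = 0` is impossible (the average would vanish), so `d > 0` and we multiply through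
  have hL1 : (1 : ℝ) ≤ (L : ℝ) := by exact_mod_cast NeZero.one_le
  have hcL : 0 < c * (L : ℝ) ^ 4 := by positivity
  have hdpos : (0 : ℝ) < (d : ℝ) := by
    rcases Nat.eq_zero_or_pos d with hd0 | hdp
    · exfalso
      rw [hd0, Nat.cast_zero, _root_.inv_zero, zero_mul] at h
      exact absurd h (not_le.mpr hcL)
    · exact_mod_cast hdp
  have h1 : c * (L : ℝ) ^ 4 ≤ (P * Y).trace.re / (d : ℝ) := by
    rwa [div_eq_inv_mul]
  exact (le_div_iff₀ hdpos).1 h1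

/-- **The crux's window hypothesis implies the sibling target's window hypothesis** (`δ ≥ -1`, `c > 0`):
the block bound for all `U ∈ (U₁, U₂)` and all even `L ≥ L₀` gives, at every `U ∈ (U₁, U₂)`, the
projector bound `c L⁴ · re tr P ≤ re tr (P Δ_d† Δ_d)` eventually in even `L` (threshold `L₀` itself).
This is the hypothesis shape of `BalabanIR.BirGroundStateAverageLRO` / `BirEveryGroundState`. [folklore] -/
theorem projWindow_of_blockWindow {δ U₁ U₂ c : ℝ} {L₀ : ℕ} (hδ : -1 ≤ δ) (hc : 0 < c)
    (hyp : ∀ U ∈ Set.Ioo U₁ U₂, ∀ (L : ℕ) [NeZero L], L₀ ≤ L → Even L →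
      let p : Finset (Orb (FermionTorus 2 L)) → Prop := fun s =>
        s.card = 2 * ⌊(1 - δ) * (L : ℝ) ^ 2 / 2⌋₊ ∧
          2 * (s.filter fun i => (ofLex i).2 = 0).card = 2 * ⌊(1 - δ) * (L : ℝ) ^ 2 / 2⌋₊
      c * (L : ℝ) ^ 4 ≤ (((hubbardTorus 2 L 1 U).toBlock p p).groundStateFunctional
        (((pairField dWaveFormFactor L)ᴴ * pairField dWaveFormFactor L).toBlock p p)).re) :
    ∀ U ∈ Set.Ioo U₁ U₂, ∃ L₀ : ℕ, ∀ (L : ℕ) [NeZero L], L₀ ≤ L → Even L →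
      let N : ℕ := 2 * ⌊(1 - δ) * (L : ℝ) ^ 2 / 2⌋₊
      let H := hubbardTorus 2 L 1 U
      let S := szSector (Λ := FermionTorus 2 L) N 0
      let E₀ := S ⊓ Module.End.eigenspace (Matrix.toLin' H) ((H.minEnergyOn S : ℝ) : ℂ)
      let P := projMatrix (E₀.map (Fock.toEuclidean (ι := Orb (FermionTorus 2 L)) :
        Fock (Orb (FermionTorus 2 L)) →ₗ[ℂ] EuclideanSpace ℂ (Finset (Orb (FermionTorus 2 L)))))
      c * (L : ℝ) ^ 4 * P.trace.re ≤
        (P * ((pairField dWaveFormFactor L)ᴴ * pairField dWaveFormFactor L)).trace.re :=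
  fun U hU => ⟨L₀, fun L _ hL hLe => projBound_of_blockBound L hδ hc (hyp U hU L hL hLe)⟩

/-! ## §2 The regime map of the crux's block witnesses -/

/-- **Yang's kinematic ceiling for block witnesses, `0 ≤ δ ≤ 1`.** If the crux's window hypothesis holds
at `(δ, U₁, U₂, c, L₀)` with `0 ≤ δ ≤ 1`, `U₁ < U₂`, `0 < c`, then `c ≤ 2(1-δ)(1+δ)` (midpoint coupling,
even sides `L → ∞` in the sibling's pointwise `avgBound_const_le_yang`). Yang (1962) §3. [folklore] -/
theorem blockWindow_const_le_yang {δ U₁ U₂ c : ℝ} {L₀ : ℕ} (hδ0 : 0 ≤ δ) (hδ1 : δ ≤ 1)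
    (hU : U₁ < U₂) (hc : 0 < c)
    (hyp : ∀ U ∈ Set.Ioo U₁ U₂, ∀ (L : ℕ) [NeZero L], L₀ ≤ L → Even L →
      let p : Finset (Orb (FermionTorus 2 L)) → Prop := fun s =>
        s.card = 2 * ⌊(1 - δ) * (L : ℝ) ^ 2 / 2⌋₊ ∧
          2 * (s.filter fun i => (ofLex i).2 = 0).card = 2 * ⌊(1 - δ) * (L : ℝ) ^ 2 / 2⌋₊
      c * (L : ℝ) ^ 4 ≤ (((hubbardTorus 2 L 1 U).toBlock p p).groundStateFunctional
        (((pairField dWaveFormFactor L)ᴴ * pairField dWaveFormFactor L).toBlock p p)).re) :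
    c ≤ 2 * (1 - δ) * (1 + δ) := by
  have h := projWindow_of_blockWindow (by linarith) hc hyp
  by_contra hlt
  push Not at hlt
  set ε : ℝ := c - 2 * (1 - δ) * (1 + δ) with hε
  have hεpos : 0 < ε := by linarith
  obtain ⟨L₁, hL₁⟩ := h ((U₁ + U₂) / 2) ⟨by linarith, by linarith⟩
  set m : ℕ := max L₁ (⌈4 / ε⌉₊ + 2) with hm
  haveI : NeZero (2 * m) := ⟨by omega⟩
  have hbound := hL₁ (2 * m) (by omega) (even_two_mul m)
  have hc' := avgBound_const_le_yang (2 * m) (by omega) hδ0 hδ1 hbound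
  -- `4(1-δ)/(2m)² ≤ 4/(2m) < ε`
  have hmR : (⌈4 / ε⌉₊ : ℝ) + 2 ≤ ((2 * m : ℕ) : ℝ) := by
    have : ⌈4 / ε⌉₊ + 2 ≤ 2 * m := by omega
    exact_mod_cast this
  have hceil : (4 / ε : ℝ) ≤ (⌈4 / ε⌉₊ : ℝ) := Nat.le_ceil _
  have hge1 : (1 : ℝ) ≤ ((2 * m : ℕ) : ℝ) := by
    have : 1 ≤ 2 * m := by omega
    exact_mod_cast this
  have hdiv : 4 / ε < ((2 * m : ℕ) : ℝ) := by linarith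
  have h4 : 4 < ε * ((2 * m : ℕ) : ℝ) := by
    have := (div_lt_iff₀ hεpos).1 hdiv
    linarith
  have hfrac : 4 * (1 - δ) / ((2 * m : ℕ) : ℝ) ^ 2 < ε := by
    rw [div_lt_iff₀ (by positivity)]
    have hδ1' : 0 ≤ 1 - δ := by linarith
    -- `4(1-δ) ≤ 4 ≤ 4·(2m) < ε (2m) ≤ ε (2m)²`
    nlinarith
  linarith

/-- **The carrier ceiling for block witnesses, `0 ≤ δ ≤ 1`.** If the crux's window hypothesis holds at
`(δ, U₁, U₂, c, L₀)` with `0 ≤ δ ≤ 1`, `0 < U₁ < U₂`, `0 < c`, then `c ≤ 80δ + 640/U₂` (couplings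
`U ↑ U₂`, even sides `L → ∞` in the sibling's pointwise `avgBound_const_le_carrier`): a window reaching
strong coupling at low doping admits only small constants. Zhang–Gross–Rice–Shiba (1988) §2. [folklore] -/
theorem blockWindow_const_le_carrier {δ U₁ U₂ c : ℝ} {L₀ : ℕ} (hδ0 : 0 ≤ δ) (hδ1 : δ ≤ 1)
    (hU₁ : 0 < U₁) (hU : U₁ < U₂) (hc : 0 < c)
    (hyp : ∀ U ∈ Set.Ioo U₁ U₂, ∀ (L : ℕ) [NeZero L], L₀ ≤ L → Even L →
      let p : Finset (Orb (FermionTorus 2 L)) → Prop := fun s =>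
        s.card = 2 * ⌊(1 - δ) * (L : ℝ) ^ 2 / 2⌋₊ ∧
          2 * (s.filter fun i => (ofLex i).2 = 0).card = 2 * ⌊(1 - δ) * (L : ℝ) ^ 2 / 2⌋₊
      c * (L : ℝ) ^ 4 ≤ (((hubbardTorus 2 L 1 U).toBlock p p).groundStateFunctional
        (((pairField dWaveFormFactor L)ᴴ * pairField dWaveFormFactor L).toBlock p p)).re) :
    c ≤ 80 * δ + 640 / U₂ := by
  have h := projWindow_of_blockWindow (by linarith) hc hyp
  have hU₂ : 0 < U₂ := hU₁.trans hU
  by_contra hlt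
  push Not at hlt
  set ε : ℝ := c - (80 * δ + 640 / U₂) with hε
  have hεpos : 0 < ε := by linarith
  -- a coupling of the window close to `U₂`: `640/U ≤ 640/U₂ + ε/2`
  set Ustar : ℝ := 1 / (1 / U₂ + ε / 1280) with hUstar
  have hden : 0 < 1 / U₂ + ε / 1280 := by positivity
  have hUstar_lt : Ustar < U₂ := by
    rw [hUstar, div_lt_iff₀ hden]
    have : U₂ * (1 / U₂) = 1 := by field_simp
    nlinarith
  set U := max Ustar ((U₁ + U₂) / 2) with hUdef
  have hUmem : U ∈ Set.Ioo U₁ U₂ :=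
    ⟨lt_of_lt_of_le (by linarith) (le_max_right _ _), max_lt hUstar_lt (by linarith)⟩
  have hU0 : 0 < U := hU₁.trans hUmem.1
  have hUge : Ustar ≤ U := le_max_left _ _
  have hinvU : 1 / U ≤ 1 / U₂ + ε / 1280 := by
    have hUstar_pos : 0 < Ustar := by rw [hUstar]; positivity
    calc 1 / U ≤ 1 / Ustar := one_div_le_one_div_of_le hUstar_pos hUge
      _ = 1 / U₂ + ε / 1280 := by rw [hUstar, one_div_one_div]
  have h640 : 640 / U ≤ 640 / U₂ + ε / 2 := by
    have := mul_le_mul_of_nonneg_left hinvU (by norm_num : (0:ℝ) ≤ 640)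
    have e1 : (640 : ℝ) * (1 / U) = 640 / U := by ring
    have e2 : (640 : ℝ) * (1 / U₂ + ε / 1280) = 640 / U₂ + ε / 2 := by ring
    linarith
  obtain ⟨L₁, hL₁⟩ := h U hUmem
  set m : ℕ := max L₁ (⌈800 / ε⌉₊ + 2) with hm
  haveI : NeZero (2 * m) := ⟨by omega⟩
  have hbound := hL₁ (2 * m) (by omega) (even_two_mul m)
  have hc' := avgBound_const_le_carrier (2 * m) (by omega) hδ0 hδ1 hU0 hbound
  -- `400/(2m)² ≤ 400/(2m) < ε/2`
  have hmR : (⌈800 / ε⌉₊ : ℝ) + 2 ≤ ((2 * m : ℕ) : ℝ) := by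
    have : ⌈800 / ε⌉₊ + 2 ≤ 2 * m := by omega
    exact_mod_cast this
  have hceil : (800 / ε : ℝ) ≤ (⌈800 / ε⌉₊ : ℝ) := Nat.le_ceil _
  have hge1 : (1 : ℝ) ≤ ((2 * m : ℕ) : ℝ) := by
    have : 1 ≤ 2 * m := by omega
    exact_mod_cast this
  have hdiv : 800 / ε < ((2 * m : ℕ) : ℝ) := by linarith
  have h8 : 800 < ε * ((2 * m : ℕ) : ℝ) := by
    have := (div_lt_iff₀ hεpos).1 hdiv
    linarith
  have hfrac : 400 / ((2 * m : ℕ) : ℝ) ^ 2 < ε / 2 := by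
    rw [div_lt_iff₀ (by positivity)]
    nlinarith
  linarith

/-- **The pairing-cost floor for block witnesses, every filling `δ ≥ -1`.** If the crux's window
hypothesis holds at `(δ, U₁, U₂, c, L₀)` with `δ ≥ -1`, `0 ≤ U₁ < U₂`, `0 < c`, then
`c/(10⁵·log²(4 + 32/√c)) ≤ U₁` (the sibling's `birGroundStateAverageLRO_window_floor_uniform` on the
transported hypothesis). Bardeen–Cooper–Schrieffer (1957) §II; Tasaki (2020) §2.2. [folklore] -/
theorem blockWindow_floor {δ U₁ U₂ c : ℝ} {L₀ : ℕ} (hδ : -1 ≤ δ) (hU₁ : 0 ≤ U₁) (hU : U₁ < U₂)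
    (hc : 0 < c)
    (hyp : ∀ U ∈ Set.Ioo U₁ U₂, ∀ (L : ℕ) [NeZero L], L₀ ≤ L → Even L →
      let p : Finset (Orb (FermionTorus 2 L)) → Prop := fun s =>
        s.card = 2 * ⌊(1 - δ) * (L : ℝ) ^ 2 / 2⌋₊ ∧
          2 * (s.filter fun i => (ofLex i).2 = 0).card = 2 * ⌊(1 - δ) * (L : ℝ) ^ 2 / 2⌋₊
      c * (L : ℝ) ^ 4 ≤ (((hubbardTorus 2 L 1 U).toBlock p p).groundStateFunctional
        (((pairField dWaveFormFactor L)ᴴ * pairField dWaveFormFactor L).toBlock p p)).re) :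
    c / (100000 * Real.log (4 + 32 / Real.sqrt c) ^ 2) ≤ U₁ :=
  birGroundStateAverageLRO_window_floor_uniform hδ hU₁ hU hc (projWindow_of_blockWindow hδ hc hyp)

/-- **The weak-coupling ceiling for block witnesses, every filling `δ ≥ -1`** (closed form of the floor,
absolute constant): if the crux's window hypothesis holds at `(δ, U₁, U₂, c, L₀)` with `δ ≥ -1`,
`0 < U₁ < U₂`, `0 < c`, then `c ≤ 10⁵ · U₁ · log²(4 + 32/√U₁)` (inversion of `blockWindow_floor` by
`le_mul_log_sq_of_le_mul_log_sq_sqrt_self'`). [folklore] -/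
theorem blockWindow_const_le_weakCeiling {δ U₁ U₂ c : ℝ} {L₀ : ℕ} (hδ : -1 ≤ δ) (hU₁ : 0 < U₁)
    (hU : U₁ < U₂) (hc : 0 < c)
    (hyp : ∀ U ∈ Set.Ioo U₁ U₂, ∀ (L : ℕ) [NeZero L], L₀ ≤ L → Even L →
      let p : Finset (Orb (FermionTorus 2 L)) → Prop := fun s =>
        s.card = 2 * ⌊(1 - δ) * (L : ℝ) ^ 2 / 2⌋₊ ∧
          2 * (s.filter fun i => (ofLex i).2 = 0).card = 2 * ⌊(1 - δ) * (L : ℝ) ^ 2 / 2⌋₊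
      c * (L : ℝ) ^ 4 ≤ (((hubbardTorus 2 L 1 U).toBlock p p).groundStateFunctional
        (((pairField dWaveFormFactor L)ᴴ * pairField dWaveFormFactor L).toBlock p p)).re) :
    c ≤ 100000 * U₁ * Real.log (4 + 32 / Real.sqrt U₁) ^ 2 := by
  have hfl := blockWindow_floor hδ hU₁.le hU hc hyp
  have hlog : 0 < Real.log (4 + 32 / Real.sqrt c) ^ 2 := by
    have := one_le_log_four_add_div_sqrt c
    positivity
  have himp : c ≤ 100000 * U₁ * Real.log (4 + 32 / Real.sqrt c) ^ 2 := by
    rw [div_le_iff₀ (by positivity)] at hfl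
    linarith
  exact le_mul_log_sq_of_le_mul_log_sq_sqrt_self' hc (by norm_num) hU₁ himp

/-- **The regime map of the crux's block witnesses.** Every datum `(δ, U₁, U₂, c, L₀)` with
`-1 ≤ δ ≤ 1`, `0 < U₁ < U₂`, `0 < c` at which the crux's window hypothesis holds satisfies: for `δ ≥ 0`
Yang's ceiling `c ≤ 2(1-δ)(1+δ)` and the carrier ceiling `c ≤ 80δ + 640/U₂`; for every such `δ` the
pairing-cost floor `c/(10⁵ log²(4+32/√c)) ≤ U₁` and the weak-coupling ceiling
`c ≤ 10⁵ U₁ log²(4+32/√U₁)`. Yang (1962) §3; Zhang–Gross–Rice–Shiba (1988) §2;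
Bardeen–Cooper–Schrieffer (1957) §II. [folklore] -/
theorem blockWindow_regimeMap {δ U₁ U₂ c : ℝ} {L₀ : ℕ} (hδ : -1 ≤ δ) (hδ1 : δ ≤ 1) (hU₁ : 0 < U₁)
    (hU : U₁ < U₂) (hc : 0 < c)
    (hyp : ∀ U ∈ Set.Ioo U₁ U₂, ∀ (L : ℕ) [NeZero L], L₀ ≤ L → Even L →
      let p : Finset (Orb (FermionTorus 2 L)) → Prop := fun s =>
        s.card = 2 * ⌊(1 - δ) * (L : ℝ) ^ 2 / 2⌋₊ ∧
          2 * (s.filter fun i => (ofLex i).2 = 0).card = 2 * ⌊(1 - δ) * (L : ℝ) ^ 2 / 2⌋₊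
      c * (L : ℝ) ^ 4 ≤ (((hubbardTorus 2 L 1 U).toBlock p p).groundStateFunctional
        (((pairField dWaveFormFactor L)ᴴ * pairField dWaveFormFactor L).toBlock p p)).re) :
    (0 ≤ δ → c ≤ 2 * (1 - δ) * (1 + δ) ∧ c ≤ 80 * δ + 640 / U₂) ∧
      c / (100000 * Real.log (4 + 32 / Real.sqrt c) ^ 2) ≤ U₁ ∧
      c ≤ 100000 * U₁ * Real.log (4 + 32 / Real.sqrt U₁) ^ 2 :=
  ⟨fun hδ0 => ⟨blockWindow_const_le_yang hδ0 hδ1 hU hc hyp,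
      blockWindow_const_le_carrier hδ0 hδ1 hU₁ hU hc hyp⟩,
    blockWindow_floor hδ hU₁.le hU hc hyp, blockWindow_const_le_weakCeiling hδ hU₁ hU hc hyp⟩

/-! ## Registered one-line form -/

/-- **Registered sub-goal `blockWindowRegimeMap`** (one-line form of `blockWindow_regimeMap`, the block
hypothesis written with its occupation predicate inlined exactly as in the crux's registered stub): every
block witness `(δ, U₁, U₂, c, L₀)` of the crux's window hypothesis with `-1 ≤ δ ≤ 1`, `0 < U₁ < U₂`,
`0 < c` lies in the regime map. [folklore] -/
theorem blockWindowRegimeMap : ∀ (δ U₁ U₂ c : ℝ) (L₀ : ℕ), -1 ≤ δ → δ ≤ 1 → 0 < U₁ → U₁ < U₂ → 0 < c → (∀ U ∈ Set.Ioo U₁ U₂, ∀ (L : ℕ) [NeZero L], L₀ ≤ L → Even L → c * (L : ℝ) ^ 4 ≤ (((hubbardTorus 2 L 1 U).toBlock (fun s : Finset (Orb (FermionTorus 2 L)) => s.card = 2 * ⌊(1 - δ) * (L : ℝ) ^ 2 / 2⌋₊ ∧ 2 * (s.filter fun i => (ofLex i).2 = 0).card = 2 * ⌊(1 - δ) * (L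 : ℝ) ^ 2 / 2⌋₊) (fun s : Finset (Orb (FermionTorus 2 L)) => s.card = 2 * ⌊(1 - δ) * (L : ℝ) ^ 2 / 2⌋₊ ∧ 2 * (s.filter fun i => (ofLex i).2 = 0).card = 2 * ⌊(1 - δ) * (L : ℝ) ^ 2 / 2⌋₊)).groundStateFunctional ((((pairField dWaveFormFactor L)ᴴ * pairField dWaveFormFactor L)).toBlock (fun s : Finset (Orb (FermionTorus 2 L)) => s.card = 2 * ⌊(1 - δ) * (L : ℝ) ^ 2 / 2⌋₊ ∧ 2 * (s.filter fun i => (ofLex i).2 = 0).card = 2 * ⌊(1 - δ) * (L : ℝ) ^ 2 / 2⌋₊) (fun s : Finset (Orb (FermionTorus 2 L)) => s.card = 2 * ⌊(1 - δ) * (L : ℝ) ^ 2 / 2⌋₊ ∧ 2 * (s.filter fun i => (ofLex i).2 = 0).card = 2 * ⌊(1 - δ) * (L : ℝ) ^ 2 / 2⌋₊))).re) → (0 ≤ δ → c ≤ 2 * (1 - δ) * (1 + δ) ∧ c ≤ 80 * δ + 640 / U₂) ∧ c / (100000 * Real.log (4 + 32 / Real.sqrt c) ^ 2) ≤ U₁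 ∧ c ≤ 100000 * U₁ * Real.log (4 + 32 / Real.sqrt U₁) ^ 2 :=
  fun _ _ _ _ _ hδ hδ1 hU₁ hU hc hyp =>
    blockWindow_regimeMap hδ hδ1 hU₁ hU hc (fun U hU L _ hL hLe => hyp U hU L hL hLe)

end Summit.HubbardSuperconductivity.HubbardSuperconductivity.Theorems

end
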